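import Summits.QuantumFields.GaugeBoot.EquipartitionBootstrapZd
import Summits.QuantumFields.GaugeBoot.BootstrapCertificatesZdUN
import Summits.QuantumFields.GaugeBoot.LoopEquationInstances
import HarnessLib

/-!
# Gauge-boot: the `U(N)` twin on `ℤ^d` — every feasible point of the `U(N)` word SDP on the infinite lattice at level
# `≥ 4`, and every `U(N)` DLR state, obeys `avg_{P∋l} u_P ≤ 1 − N/(4(d−1)β + N)` (large-`N` supplement 19, part 7)

HONEST FRAMING (cell `pub-gaugeboot`, page 1 of every file): certified bounds on lattice
expectations at STATED coupling, gauge group, dimension and torus size; NOT a mass gap, NOT a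
continuum limit, NOT a string tension, NOT large `N`; NOT Yang–Mills-summit-bearing (barriers
`FixedCouplingUltralocality`, `PerturbativeInvisibility`).  An a-priori ceiling; it certifies no number of CERTIFIED.md.

## Content

The `U(N)` analogue of parts 4–5 (`EquipartitionBootstrapZd`, `EquipartitionDLR`): weight `s = 0`, `c = N`, rows for
every direction of `𝔲(N)` (`uExp`, `sdPairF_of_skew`).  The bound `1 − N/(4(d−1)β + N) = 1 − 1/(4(d−1)β/N + 1)` is
UNIFORM IN `N` at fixed 't Hooft-normalised coupling `β/N` — the normalisation of Kazakov–Zheng's planar rows: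

* ★★ `sdPairF_of_isBootstrapFeasible_zdUN`;
* ★★★ `sum_plaquette_le_of_isBootstrapFeasible_zdUN` / `avg_…` — `N ≥ 1`, `d ≥ 2`, `β ≥ 0`, level `n ≥ 4`:
  `Σ_{ν ≠ a} (φ(u_{x;aν}) + φ(u_{x−e_ν;aν})) ≤ 2(d−1)·(1 − N/(4(d−1)β + N))`;
* ★★★ `sum_integral_plaquette_le_of_mem_ymGibbsMeasures_uN` — the same for every `U(N)` DLR state on `ℤ^d`
  (`isBootstrapFeasible_dlr_uN`).
[folklore]
-/

noncomputable section

open MeasureTheory Filter Topology NormedSpace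
open scoped Matrix.Norms.Frobenius Matrix
open Literature.MathematicalPhysics.QuantumFieldTheory (LatticeRep)
open Literature.Probability.LatticeModels (Site)
open Literature.MathematicalPhysics.QuantumLattice (unitaryFundamentalLatticeRep unitaryFundamentalRep
  unitaryFundamentalLatticeRep_N LGConfig ZdEdge plaquetteObs plaquetteHolonomyZd wilsonBoundaryAction ymGibbsMeasures)

namespace Summit.QuantumFields.GaugeBoot

namespace TiltedRP

/-! ## Feasible functionals of the `U(N)` word SDP on `ℤ^d` have the pair rows -/

section ZdUN

variable {d N : ℕ}

/-- ★★ **A level-`n` feasible functional of the `U(N)` word SDP on `ℤ^d` has the pair rows** (`TiltedRP.SDPairF` at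
`e = zdUnit`) for every word of length `≤ n` and EVERY direction `X` (no trace condition: `𝔲(N)`). [folklore] -/
theorem sdPairF_of_isBootstrapFeasible_zdUN {n : ℕ} {β : ℝ}
    {φ : C(LGConfig d (Matrix.unitaryGroup (Fin N) ℂ), ℝ) →ₗ[ℝ] ℝ}
    (hφ : IsBootstrapFeasible (unitaryFundamentalLatticeRep N) (uExp N)
      (fun e => wilsonBoundaryAction (unitaryFundamentalRep (Fin N) ℂ) {e}) β
      (wordTruncation (ι := ZdEdge d) (unitaryFundamentalLatticeRep N) n) φ)
    (x : Site d) (μ : Fin d) (x₀ : Site d) (w : Word d) (hw : w.length ≤ n)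
    (X : Matrix (Fin N) (Fin N) ℂ) :
    SDPairF (unitaryFundamentalLatticeRep N) (zdUnit d) φ β x μ x₀ w X := by
  refine sdPairF_of_skew (unitaryFundamentalLatticeRep N) (zdUnit d) φ β x μ x₀ w (fun Z hZs => ?_) X
  clear X
  -- the direction as a generator of `U(N)`
  have hZskew : (Z : Matrix (Fin N) (Fin N) ℂ) ∈ skewAdjoint (Matrix (Fin N) (Fin N) ℂ) := by
    change star Z = -Z
    rw [Matrix.star_eq_conjTranspose]; exact hZs
  let Zg : UGenerator N := ⟨Z, hZskew⟩
  have hk : ∀ s t, uExp N Zg (s + t) = uExp N Zg s * uExp N Zg t := uExp_add N Zg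
  have hkX : ∀ t, (unitaryFundamentalLatticeRep N).ρ (uExp N Zg t) = exp ((t : ℂ) • Z) := fun t => rho_uExp N Zg t
  -- the action derivative of the feasibility witness is `actionDerivZd`
  obtain ⟨S', -, hS'der, hrows⟩ := hφ.2.2 (x, μ) Zg
  have hS' : ∀ U, S' U = actionDerivZd (unitaryFundamentalLatticeRep N).ρ (x, μ) Z U := fun U =>
    (hS'der U).unique (hasDerivAt_wilsonBoundaryAction (x, μ) hk hkX U)
  intro Y
  -- the test functions `Re/Im tr(Y ρ(hol_w))` and their derivatives `Re/Im tr(Y insDeriv)` are word functions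
  have hV : EntriesIn (unitaryFundamentalLatticeRep N) (Set.univ : Set (ZdEdge d)) w.length
      (fun U : LGConfig d _ => Y * (unitaryFundamentalLatticeRep N).ρ (wordHolonomy (zdUnit d) U x₀ w)) := by
    simpa only [zero_add] using (entriesIn_const (unitaryFundamentalLatticeRep N) (Set.univ : Set (ZdEdge d)) 0 Y).mul
      (unitaryFundamentalLatticeRep N) (entriesIn_wordHolonomy (unitaryFundamentalLatticeRep N) (zdUnit d) x₀ w)
  have hD : EntriesIn (unitaryFundamentalLatticeRep N) (Set.univ : Set (ZdEdge d)) w.length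
      (fun U : LGConfig d _ => Y * insDeriv (unitaryFundamentalLatticeRep N).ρ (zdUnit d) (x, μ) Z U x₀ w) := by
    simpa only [zero_add] using (entriesIn_const (unitaryFundamentalLatticeRep N) (Set.univ : Set (ZdEdge d)) 0 Y).mul
      (unitaryFundamentalLatticeRep N) (entriesIn_insDeriv (unitaryFundamentalLatticeRep N) (zdUnit d) (x, μ) Z x₀ w)
  obtain ⟨gre, hgre, hgre'⟩ := (mem_wordFunctions_iff (unitaryFundamentalLatticeRep N)).1 hV.trace_re
  obtain ⟨gim, hgim, hgim'⟩ := (mem_wordFunctions_iff (unitaryFundamentalLatticeRep N)).1 (hV.trace_im (unitaryFundamentalLatticeRep N))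
  obtain ⟨dre, hdre, hdre'⟩ := (mem_wordFunctions_iff (unitaryFundamentalLatticeRep N)).1 hD.trace_re
  obtain ⟨dim, hdim, hdim'⟩ := (mem_wordFunctions_iff (unitaryFundamentalLatticeRep N)).1 (hD.trace_im (unitaryFundamentalLatticeRep N))
  have hgreV : gre ∈ wordTruncation (ι := ZdEdge d) (unitaryFundamentalLatticeRep N) n :=
    wordTruncation_mono (unitaryFundamentalLatticeRep N) hw (mem_wordTruncation_of_mem_wordSpace (unitaryFundamentalLatticeRep N) hgre)
  have hgimV : gim ∈ wordTruncation (ι := ZdEdge d) (unitaryFundamentalLatticeRep N) n :=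
    wordTruncation_mono (unitaryFundamentalLatticeRep N) hw (mem_wordTruncation_of_mem_wordSpace (unitaryFundamentalLatticeRep N) hgim)
  -- the derivative facts along the shift `U ↦ U[l ↦ e^{tZ} U_l]` (chain rule with a real-linear map)
  have hder_re : ∀ U : LGConfig d (Matrix.unitaryGroup (Fin N) ℂ),
      HasDerivAt (fun t : ℝ => gre (Function.update U (x, μ) (uExp N Zg t * U (x, μ)))) (dre U) 0 := by
    intro U
    have h1 := hasDerivAt_wordHolonomy (zdUnit d) (x, μ) hk hkX U x₀ w
    have h2 := (Complex.reCLM.comp (traceMulLeftCLM Y)).hasFDerivAt.comp_hasDerivAt (0 : ℝ) h1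
    have e1 : (fun t : ℝ => gre (Function.update U (x, μ) (uExp N Zg t * U (x, μ)))) =
        (⇑(Complex.reCLM.comp (traceMulLeftCLM Y)) ∘ fun t : ℝ =>
          (unitaryFundamentalLatticeRep N).ρ (wordHolonomy (zdUnit d) (Function.update U (x, μ) (uExp N Zg t * U (x, μ))) x₀ w)) := by
      funext t
      simp only [Function.comp_apply, ContinuousLinearMap.comp_apply, traceMulLeftCLM_apply, Complex.reCLM_apply, hgre']
    have e2 : dre U = (Complex.reCLM.comp (traceMulLeftCLM Y))
        (insDeriv (unitaryFundamentalLatticeRep N).ρ (zdUnit d) (x, μ) Z U x₀ w) := by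
      simp only [ContinuousLinearMap.comp_apply, traceMulLeftCLM_apply, Complex.reCLM_apply, hdre']
    rw [e1, e2]
    exact h2
  have hder_im : ∀ U : LGConfig d (Matrix.unitaryGroup (Fin N) ℂ),
      HasDerivAt (fun t : ℝ => gim (Function.update U (x, μ) (uExp N Zg t * U (x, μ)))) (dim U) 0 := by
    intro U
    have h1 := hasDerivAt_wordHolonomy (zdUnit d) (x, μ) hk hkX U x₀ w
    have h2 := (Complex.imCLM.comp (traceMulLeftCLM Y)).hasFDerivAt.comp_hasDerivAt (0 : ℝ) h1
    have e1 : (fun t : ℝ => gim (Function.update U (x, μ) (uExp N Zg t * U (x, μ)))) =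
        (⇑(Complex.imCLM.comp (traceMulLeftCLM Y)) ∘ fun t : ℝ =>
          (unitaryFundamentalLatticeRep N).ρ (wordHolonomy (zdUnit d) (Function.update U (x, μ) (uExp N Zg t * U (x, μ))) x₀ w)) := by
      funext t
      simp only [Function.comp_apply, ContinuousLinearMap.comp_apply, traceMulLeftCLM_apply, Complex.imCLM_apply, hgim']
    have e2 : dim U = (Complex.imCLM.comp (traceMulLeftCLM Y))
        (insDeriv (unitaryFundamentalLatticeRep N).ρ (zdUnit d) (x, μ) Z U x₀ w) := by
      simp only [ContinuousLinearMap.comp_apply, traceMulLeftCLM_apply, Complex.imCLM_apply, hdim']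
    rw [e1, e2]
    exact h2
  -- the rows
  have hrow_re := hrows gre hgreV dre (mem_polyAlgebra_of_mem_wordSpace (unitaryFundamentalLatticeRep N) hdre) hder_re
  have hrow_im := hrows gim hgimV dim (mem_polyAlgebra_of_mem_wordSpace (unitaryFundamentalLatticeRep N) hdim) hder_im
  -- the right-hand side `tr(Y ρ(hol_w))·(−½ plaqIns_Z)` is `tr(Y ρ(hol_w))·S'` (a real factor)
  have hrhs : ∀ U, (Y * (unitaryFundamentalLatticeRep N).ρ (wordHolonomy (zdUnit d) U x₀ w)).trace *
      (-(1 / 2) * plaqIns (unitaryFundamentalLatticeRep N).ρ (zdUnit d) Z U x μ) =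
      (Y * (unitaryFundamentalLatticeRep N).ρ (wordHolonomy (zdUnit d) U x₀ w)).trace * ((S' U : ℝ) : ℂ) := fun U => by
    rw [hS' U, actionDerivZd_eq_plaqIns hZs (unitaryFundamentalLatticeRep N).mem_unitary U x μ]
  have hLre : evalR φ (fun U => ((Y * insDeriv (unitaryFundamentalLatticeRep N).ρ (zdUnit d) (x, μ) Z U x₀ w).trace).re) =
      φ dre := by
    rw [← hdre', evalR_coe]
  have hLim : evalR φ (fun U => ((Y * insDeriv (unitaryFundamentalLatticeRep N).ρ (zdUnit d) (x, μ) Z U x₀ w).trace).im) =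
      φ dim := by
    rw [← hdim', evalR_coe]
  have hRre : evalR φ (fun U => ((Y * (unitaryFundamentalLatticeRep N).ρ (wordHolonomy (zdUnit d) U x₀ w)).trace *
      (-(1 / 2) * plaqIns (unitaryFundamentalLatticeRep N).ρ (zdUnit d) Z U x μ)).re) = φ (gre * S') := by
    have e1 : (fun U => ((Y * (unitaryFundamentalLatticeRep N).ρ (wordHolonomy (zdUnit d) U x₀ w)).trace *
        (-(1 / 2) * plaqIns (unitaryFundamentalLatticeRep N).ρ (zdUnit d) Z U x μ)).re) = ⇑(gre * S') := by
      funext U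
      rw [hrhs U, Complex.re_mul_ofReal, ContinuousMap.mul_apply, hgre']
    rw [e1, evalR_coe]
  have hRim : evalR φ (fun U => ((Y * (unitaryFundamentalLatticeRep N).ρ (wordHolonomy (zdUnit d) U x₀ w)).trace *
      (-(1 / 2) * plaqIns (unitaryFundamentalLatticeRep N).ρ (zdUnit d) Z U x μ)).im) = φ (gim * S') := by
    have e1 : (fun U => ((Y * (unitaryFundamentalLatticeRep N).ρ (wordHolonomy (zdUnit d) U x₀ w)).trace *
        (-(1 / 2) * plaqIns (unitaryFundamentalLatticeRep N).ρ (zdUnit d) Z U x μ)).im) = ⇑(gim * S') := by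
      funext U
      rw [hrhs U, Complex.im_mul_ofReal, ContinuousMap.mul_apply, hgim']
    rw [e1, evalR_coe]
  apply Complex.ext
  · rw [evalC_re, hLre, Complex.re_ofReal_mul, evalC_re, hRre, hrow_re]
  · rw [evalC_im, hLim, Complex.im_ofReal_mul, evalC_im, hRim, hrow_im]

namespace Equipartition

/-- ★★★ **THE EQUIPARTITION BOUND AT EVERY FEASIBLE POINT OF THE `U(N)` WORD SDP ON `ℤ^d`.**  For `N ≥ 1`,
`d ≥ 2`, tree coupling `β ≥ 0`, every link `(x, a)` of the infinite lattice and every functional `φ` feasible for the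
word-level-`n` bootstrap on `ℤ^d` (one-link Wilson boundary actions) with `n ≥ 4`:
`Σ_{ν ≠ a} (φ(u_{x;aν}) + φ(u_{x−e_ν;aν})) ≤ 2(d−1)·(1 − N/(4(d−1)β + N))` — the sum over the `2(d−1)`
plaquettes containing the link, `u = plaquetteZdCM` the normalised plaquette. [folklore] -/
theorem sum_plaquette_le_of_isBootstrapFeasible_zdUN (hN : 1 ≤ N) {n : ℕ} (hn : 4 ≤ n) (hd : 2 ≤ d) {β : ℝ}
    (hβ : 0 ≤ β) {φ : C(LGConfig d (Matrix.unitaryGroup (Fin N) ℂ), ℝ) →ₗ[ℝ] ℝ}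
    (hφ : IsBootstrapFeasible (unitaryFundamentalLatticeRep N) (uExp N)
      (fun e => wilsonBoundaryAction (unitaryFundamentalRep (Fin N) ℂ) {e}) β
      (wordTruncation (ι := ZdEdge d) (unitaryFundamentalLatticeRep N) n) φ)
    (x : Site d) (a : Fin d) :
    (∑ ν ∈ Finset.univ.erase a, (φ (plaquetteZdCM (unitaryFundamentalLatticeRep N) x a ν) +
        φ (plaquetteZdCM (unitaryFundamentalLatticeRep N) (x - zdUnit d ν) a ν))) ≤
      2 * ((d : ℝ) - 1) * (1 - (N : ℝ) / (4 * ((d : ℝ) - 1) * β + N)) := by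
  have hN2 : (0 : ℝ) < ((unitaryFundamentalLatticeRep N).N : ℝ) ^ 2 := by
    rw [unitaryFundamentalLatticeRep_N]
    have : (1 : ℝ) ≤ N := by exact_mod_cast hN
    positivity
  have hP : ∀ ν ∈ Finset.univ.erase a, ∀ (ε : Bool) (i j : Fin (unitaryFundamentalLatticeRep N).N),
      SDPairF (unitaryFundamentalLatticeRep N) (zdUnit d) φ β x a x (plaqWord a ν ε) (unitDir ((0 : ℝ) : ℂ) i j) := by
    intro ν _ ε i j
    rw [Complex.ofReal_zero]
    exact sdPairF_of_isBootstrapFeasible_zdUN hφ x a x (plaqWord a ν ε) ((length_plaqWord a ν ε).trans_le hn) _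
  have h := sum_evalR_plaquette_le_of_sdPairF (unitaryFundamentalLatticeRep N) (zdUnit d) φ zdUnit_ne_zero hd hβ x a
    le_rfl hN2 hn hφ.1 hφ.2.1 hP
  have hev : ∀ ν, (∑ ε : Bool, evalR φ (fun U => ((unitaryFundamentalLatticeRep N).N : ℝ)⁻¹ *
      ((unitaryFundamentalLatticeRep N).ρ (wordHolonomy (zdUnit d) U x (plaqWord a ν ε))).trace.re)) =
      φ (plaquetteZdCM (unitaryFundamentalLatticeRep N) x a ν) +
        φ (plaquetteZdCM (unitaryFundamentalLatticeRep N) (x - zdUnit d ν) a ν) := fun ν => by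
    rw [Fintype.sum_bool, evalR_plaqWord_true, evalR_plaqWord_false]
  simp only [hev] at h
  simpa [unitaryFundamentalLatticeRep_N] using h

/-- The same for the AVERAGE over the `2(d−1)` plaquettes containing the link:
`(1/(2(d−1)))·Σ_{ν≠a} (φ(u_{x;aν}) + φ(u_{x−e_ν;aν})) ≤ 1 − N/(4(d−1)β + N)`. [folklore] -/
theorem avg_plaquette_le_of_isBootstrapFeasible_zdUN (hN : 1 ≤ N) {n : ℕ} (hn : 4 ≤ n) (hd : 2 ≤ d) {β : ℝ}
    (hβ : 0 ≤ β) {φ : C(LGConfig d (Matrix.unitaryGroup (Fin N) ℂ), ℝ) →ₗ[ℝ] ℝ}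
    (hφ : IsBootstrapFeasible (unitaryFundamentalLatticeRep N) (uExp N)
      (fun e => wilsonBoundaryAction (unitaryFundamentalRep (Fin N) ℂ) {e}) β
      (wordTruncation (ι := ZdEdge d) (unitaryFundamentalLatticeRep N) n) φ)
    (x : Site d) (a : Fin d) :
    (2 * ((d : ℝ) - 1))⁻¹ * (∑ ν ∈ Finset.univ.erase a, (φ (plaquetteZdCM (unitaryFundamentalLatticeRep N) x a ν) +
        φ (plaquetteZdCM (unitaryFundamentalLatticeRep N) (x - zdUnit d ν) a ν))) ≤
      1 - (N : ℝ) / (4 * ((d : ℝ) - 1) * β + N) := by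
  have hd0 : (0 : ℝ) < 2 * ((d : ℝ) - 1) := by
    have : (2 : ℝ) ≤ d := by exact_mod_cast hd
    linarith
  rw [inv_mul_le_iff₀ hd0]
  exact sum_plaquette_le_of_isBootstrapFeasible_zdUN hN hn hd hβ hφ x a

end Equipartition

/-! ## Every `U(N)` DLR state on `ℤ^d` -/

/-- ★★★ **THE EQUIPARTITION BOUND FOR EVERY `U(N)` INFINITE-VOLUME GIBBS STATE.**  `U(N)` lattice gauge theory on `ℤ^d`
(`N ≥ 1`, `d ≥ 2`), Wilson action at tree coupling `β ≥ 0`, `μ ∈ 𝒢(β)` any DLR state, `(x, a)` any link: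
`Σ_{ν ≠ a} (∫ u_{x;aν} dμ + ∫ u_{x−e_ν;aν} dμ) ≤ 2(d−1)·(1 − N/(4(d−1)β + N))`. [folklore] -/
theorem sum_integral_plaquette_le_of_mem_ymGibbsMeasures_uN (hN : 1 ≤ N) (hd : 2 ≤ d) {β : ℝ} (hβ : 0 ≤ β)
    {μ : Measure (LGConfig d (Matrix.unitaryGroup (Fin N) ℂ))}
    (hμ : μ ∈ ymGibbsMeasures (d := d) (unitaryFundamentalRep (Fin N) ℂ) β) (x : Site d) (a : Fin d) :
    (∑ ν ∈ Finset.univ.erase a, (∫ U, (N : ℝ)⁻¹ * plaquetteObs (unitaryFundamentalRep (Fin N) ℂ) x a ν U ∂μ +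
        ∫ U, (N : ℝ)⁻¹ * plaquetteObs (unitaryFundamentalRep (Fin N) ℂ) (x - zdUnit d ν) a ν U ∂μ)) ≤
      2 * ((d : ℝ) - 1) * (1 - (N : ℝ) / (4 * ((d : ℝ) - 1) * β + N)) := by
  haveI := hμ.1
  have hφ := isBootstrapFeasible_dlr_uN (d := d) (N := N) (β := β) hμ
    (wordTruncation_subset_polyAlgebra (unitaryFundamentalLatticeRep N) 4)
  have h := Equipartition.sum_plaquette_le_of_isBootstrapFeasible_zdUN hN le_rfl hd hβ hφ x a
  simpa only [expectationFunctional_apply, plaquetteZdCM_apply, unitaryFundamentalLatticeRep_N,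
    unitaryFundamentalLatticeRep_ρ] using h

end ZdUN

end TiltedRP

end Summit.QuantumFields.GaugeBoot

end
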